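import Literature.MathematicalPhysics.QuantumFieldTheory.Balaban1983to89.B9Eq315QFlatNorm

/-!
# `Balaban1983to89.B9Eq315QFlatSweep` — T. Bałaban, *Propagators for lattice gauge theories in a background field*, Commun. Math. Phys. **99** (1985)
# 389–434 [Balaban1985BackgroundPropagators] (3.15)–(3.16) p. 393, (3.11) p. 392, with [Balaban1985Averaging] (125) p. 36 and (1)–(2) p. 17: **THE SWEEPS
# OF THE FLAT ONE-STEP VECTOR AVERAGING ON THE NE9 CHAIN's WEIGHTED CARRIERS** — the coarse bond `⟨y, y + e_κ⟩` reads the `L^{d+1}` fine bonds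
# `⟨(L·y + r + ie_κ) mod L·m, · + e_κ⟩` (`r ∈ [0,L)^d`, `i < L`); (i) the SWEEP COUNT `Σ_c L^{−(d+1)}Σ_{sweep(c)} g ≤ L^{−d}Σ_b g(b)` (`g ≥ 0`), (ii) the
# `L²` TRANSFER «pointwise `≤ K·L^{−(d+1)}Σ_{sweep}‖f‖²` ⟹ `≤ K·(c₁∕(c₀L^d))·‖f‖²` in squared norm» (volume-free), (iii) `Q(1)` on the carriers IS the sweep
# mean — the fibre readings `φ`, `φ⁻¹` CANCEL — and (iv) the letter `t₃`: `‖Q(1)f‖ ≤ √(c₁∕(c₀L^d))·‖f‖` with NO `M_φM_φ′` — route R2′ STEP B8′ (S-P7),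
# instance-ledger row L5 of `t4/ROUTES-NE9.md` v13.33 for kernel 7's third local letter `T₃ = √a·Q_U` at the flat background

statement-level skeleton of published theorems with citation tags; proofs where landed; nothing here is a claim about the Yang–Mills mass gap

CITATION HEADER (lean-in-tree rule).  Audit cell `pub-balaban`, sub-cell `t4`, BINDER row NE9; filed by NE9 formalisation-swarm LEAF PROVER 01
(`b2b-balaban-t4-ne9-formalise-leaf-01`, gen 82), the lineage of the IMS files `B9Eq387QuadraticPartitionIMS` ∕ `B9Eq387IMSAssembly` (kernel 7's port) ∕
`B9Eq387IMSLocalLettersLattice`, as the geometric base of the two sequels `B9Eq3102LeibnizCommutatorAveraging` (the Leibniz letters of `Q(1)`, pointwise)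
and `B9Eq387IMSAveragingLettersLattice` (the carrier letters `a₃`, `k₃`, `t₃k₃`, the (dn) row, the tree-partition instance).  The operator is the VECTOR
averaging `Q(U)` of (3.15) on 1-forms — the third local letter `√a·Q_U` of the bond form of (3.26) `Δ_a(U) = Δ(U) + DRD* + Q*aQ` localised by kernel 7
(«`T_i ∈ {D_U, D_U†, √a·Q_U}`»; NOT the scalar `Q′` of (3.19), which enters B8′ only through `R(U)`) —, read on the torus by the NE9 owner's
`B9Eq315QTorus.QtorusW` and given at `U = 1` in closed form by NE9 leaf-03's `B9Eq315QFlatNorm.QtorusLin_one_apply` ([B7] (125) at `V₀ = 1`), whose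
`sum_chart_le` (injective shifted block charts) and `sum_norm_sq_QtorusLin_one_le` (the count for `g = ‖A‖²`) this file generalises and re-reads.  Sources
READ by this seat in the held text `paper:balaban1985-cmp99-background-propagators` (journal page = PDF page + 388): p. 392 (3.11), p. 393 (3.15)–(3.16).

THE PRINT (verbatim).  p. 393, (3.15): *«We are interested in the linear operators Q_j(U). They are compositions of j one-step averaging operators
Q_j(U) = Q(Ū^{j−1})…Q(Ū)Q(U), where Q(V) is given by the explicit formula (124) in [5].»*; (3.16): *«⟨A, Q*aQA⟩ = Σ_{j=0}^{k} a Σ_{b∈Λ_j} (L^jη)^{d−2}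
|(Q_j(U)A)(b)|².»*; p. 392, (3.11): *«⟨A, J⟩ = Σ_b η^d tr A(b)J(b)»* (the weighted pairings of the carriers).  [B7] (125) p. 36 is the flat main term, typed
as `B7Prop3Flat.Q0form` and read on the torus by `QtorusLin_one_apply`: the MEAN over the `L^{d+1}` bonds of the sweep.

WHAT IS PROVED (sorry-free; proof lane — no `def`, no `Prop` placeholder; [folklore] finite sums, Cauchy–Schwarz and leaf-03's chart count; nothing of
[B9] asserted).
* §1 THE SWEEP (no background, no fibre reading; weights `c₀` fine ∕ `c₁` coarse as `Fact`s where norms occur): **`sum_sweep_mean_le`** (the count),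
  `sq_sweep_mean_le` (`(L^{−(d+1)}Σ_{sweep} a)² ≤ L^{−(d+1)}Σ_{sweep} a²`), `norm_sweep_weight`, **`sum_norm_sq_le_of_sweep_bound`** (THE `L²` TRANSFER for
  a finite family `G_j` of coarse 1-forms against one fine 1-form `f`), `norm_sq_le_of_sweep_bound`, `norm_le_of_sweep_bound` (one `G`; square root).
* §2 AT THE FLAT BACKGROUND (`QtorusW … (fun _ => 1) …` under the tree's displayed regularity letters `hα1′`, `hU1′`, `hreg′`, exactly as in
  `B9Eq315QFlatNorm` §2–§3): **`QtorusW_one_apply_eq_sum`** (`(Q(1)f)(y, κ) = L^{−(d+1)}Σ_{r}Σ_{i<L} f((L·y + r + ie_κ) mod L·m, κ)` ON THE CARRIERS —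
  `φ⁻¹(L^{−(d+1)}Σ φ(·)) = L^{−(d+1)}Σ (·)` by linearity), `norm_sq_QtorusW_one_apply_le` (pointwise Cauchy–Schwarz), **`norm_sq_QtorusW_one_le`** ∕
  **`norm_QtorusW_one_le`** (`‖Q(1)f‖ ≤ √(c₁∕(c₀L^d))·‖f‖` — `B9Eq315QFlatNorm.norm_QtorusW_one_le` WITHOUT its factor `M_φ′M_φ`; `= ‖f‖` at `c₁ = c₀L^d`).
HONEST SCOPE.  Bookkeeping on the chain's OWN flat averaging; ONLY `U = 1` (the general background is the tree's `θ_Q`-letter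
`B9Eq315QLipschitzL2.norm_QtorusW_sub_flat_le_local`, not touched); no cutoff, no commutator here (the sequels'); NOT an estimate of [B9]; rows of ONE
sub-step of a route step, NOT NE9 (cell pub-balaban: NE9 NOT PRINTED ∕ NOT PROVED; «NE9 ⇐ the named binders»; row WALLED ON A MODEL (O-NE9-1); spine
PROVED 0∕9; rung (B)+1 on a finite T⁴ — NOT infinite volume, NOT mass gap, NOT Clay; HONEST DEPENDENCY: continuum YM on T⁴ ⇐ BetaPertH ∧ nine spine
estimates (0/9 proved); BetaPertH ⇐ (D1) ∧ (D4) ∧ CAP+tail; G-an2-4 gates asym, D1 and NE2/3/4).  NEW file importing `B9Eq315QFlatNorm` only; nothing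
modified.  Net new unproved facts: 0.
-/

noncomputable section

open scoped BigOperators InnerProductSpace ComplexConjugate
open Finset

namespace Literature.MathematicalPhysics.QuantumFieldTheory.Balaban1983to89.B9Eq315QFlatSweep

open B7Prop1Explicit (U1 Wcx boxVec e)
open B4Sect5Torus (TSite)
open B9SectCLatticeCarrier (Bond bpos)
open B9Eq319QprimeTorus (fineP)
open B9Eq311L2Pairing (WL2)
open B11Eq103H1Complex (BondL2K)
open B9Eq315QTorus (perSite perCfg cornerSite QtorusLin QtorusW QtorusW_apply)
open B9Eq315QFlatNorm (QtorusLin_one_apply sum_chart_le)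

variable {d : ℕ} (L : ℕ) (m : Fin d → ℕ) [∀ i, NeZero (fineP L m i)] (hL : 1 ≤ L)

/-! ## §1 The sweep of a coarse bond: the count, Cauchy–Schwarz, and the `L²` transfer on the weighted carriers (no background, no fibre reading) -/

section Sweep

variable {W : Type*} [NormedAddCommGroup W] [InnerProductSpace ℂ W] {c₀ c₁ : ℝ}

include hL in
/-- **THE SWEEP COUNT**: for a non-negative function `g` on the fine bonds, the means of `g` over the sweeps of the coarse bonds
(`L^{d+1}` fine bonds `⟨L·y + r + ie_κ, · + e_κ⟩` per coarse bond `⟨y, y + e_κ⟩`) sum to at most `L^{−d}·Σ_b g(b)` — each fine bond is swept by exactly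
`L` coarse bonds (ne9-leaf-03's injective shifted block charts `B9Eq315QFlatNorm.sum_chart_le`, one per shift `ie_κ`); volume-free.
[folklore] [cite: Balaban1985Averaging, (125) p.36, (1)–(2) p.17; Balaban1985BackgroundPropagators, (3.15)–(3.16) p.393] -/
theorem sum_sweep_mean_le (g : Bond d (fineP L m) → ℝ) (hg : ∀ b, 0 ≤ g b) :
    ∑ c : Bond d m, ((L : ℝ) ^ (d + 1))⁻¹ * ∑ r : Fin d → Fin L, ∑ i ∈ Finset.range L,
        g (perSite (fineP L m) (cornerSite L c.1 + boxVec L r + (i : ℤ) • e c.2), c.2) ≤ ((L : ℝ) ^ d)⁻¹ * ∑ b, g b := by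
  haveI : NeZero L := ⟨by omega⟩
  have hL0 : (L : ℝ) ≠ 0 := by exact_mod_cast (by omega : L ≠ 0)
  set t : Fin d → ℕ → TSite d m → (Fin d → Fin L) → ℝ :=
    fun κ i y r => g (perSite (fineP L m) (cornerSite L y + boxVec L r + (i : ℤ) • e κ), κ) with ht
  have hshift : ∀ (κ : Fin d) (i : ℕ), ∑ p : TSite d m × (Fin d → Fin L), t κ i p.1 p.2 ≤ ∑ x : TSite d (fineP L m), g (x, κ) :=
    fun κ i => sum_chart_le L m ((i : ℤ) • e κ) (g := fun x => g (x, κ)) fun x => hg _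
  have hre : ∑ c : Bond d m, ∑ r : Fin d → Fin L, ∑ i ∈ Finset.range L, t c.2 i c.1 r =
      ∑ κ : Fin d, ∑ i ∈ Finset.range L, ∑ p : TSite d m × (Fin d → Fin L), t κ i p.1 p.2 := by
    rw [Fintype.sum_prod_type, Finset.sum_comm]
    refine Finset.sum_congr rfl fun κ _ => ?_
    calc ∑ y : TSite d m, ∑ r : Fin d → Fin L, ∑ i ∈ Finset.range L, t κ i y r
        = ∑ y : TSite d m, ∑ i ∈ Finset.range L, ∑ r : Fin d → Fin L, t κ i y r := Finset.sum_congr rfl fun y _ => Finset.sum_comm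
      _ = ∑ i ∈ Finset.range L, ∑ y : TSite d m, ∑ r : Fin d → Fin L, t κ i y r := Finset.sum_comm
      _ = ∑ i ∈ Finset.range L, ∑ p : TSite d m × (Fin d → Fin L), t κ i p.1 p.2 :=
          Finset.sum_congr rfl fun i _ => (Fintype.sum_prod_type' _).symm
  have hb : ∑ b : Bond d (fineP L m), g b = ∑ κ : Fin d, ∑ x : TSite d (fineP L m), g (x, κ) := by
    rw [Fintype.sum_prod_type, Finset.sum_comm]
  calc ∑ c : Bond d m, ((L : ℝ) ^ (d + 1))⁻¹ * ∑ r : Fin d → Fin L, ∑ i ∈ Finset.range L, t c.2 i c.1 r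
      = ((L : ℝ) ^ (d + 1))⁻¹ * ∑ κ : Fin d, ∑ i ∈ Finset.range L, ∑ p : TSite d m × (Fin d → Fin L), t κ i p.1 p.2 := by
        rw [← Finset.mul_sum, hre]
    _ ≤ ((L : ℝ) ^ (d + 1))⁻¹ * ∑ κ : Fin d, ∑ _i ∈ Finset.range L, ∑ x : TSite d (fineP L m), g (x, κ) :=
        mul_le_mul_of_nonneg_left (Finset.sum_le_sum fun κ _ => Finset.sum_le_sum fun i _ => hshift κ i) (by positivity)
    _ = ((L : ℝ) ^ d)⁻¹ * ∑ b, g b := by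
        rw [hb]
        simp only [Finset.sum_const, Finset.card_range, nsmul_eq_mul]
        rw [← Finset.mul_sum, pow_succ]
        field_simp

include hL in
/-- **CAUCHY–SCHWARZ OVER ONE SWEEP**: `(L^{−(d+1)}·Σ_{sweep} a)² ≤ L^{−(d+1)}·Σ_{sweep} a²` (the `L^{d+1}` terms of a mean). [folklore]
[cite: Balaban1985Averaging, (125) p.36] -/
theorem sq_sweep_mean_le (a : (Fin d → Fin L) → ℕ → ℝ) :
    (((L : ℝ) ^ (d + 1))⁻¹ * ∑ r : Fin d → Fin L, ∑ i ∈ Finset.range L, a r i) ^ 2 ≤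
      ((L : ℝ) ^ (d + 1))⁻¹ * ∑ r : Fin d → Fin L, ∑ i ∈ Finset.range L, a r i ^ 2 := by
  haveI : NeZero L := ⟨by omega⟩
  have hLd : (0 : ℝ) < (L : ℝ) ^ (d + 1) := by positivity
  set T : Finset ((Fin d → Fin L) × ℕ) := (Finset.univ : Finset (Fin d → Fin L)) ×ˢ Finset.range L with hT
  have hcard : (T.card : ℝ) = (L : ℝ) ^ (d + 1) := by
    rw [hT, Finset.card_product, Finset.card_univ, Fintype.card_fun, Fintype.card_fin, Fintype.card_fin, Finset.card_range]
    push_cast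
    ring
  have h1 : ∑ r : Fin d → Fin L, ∑ i ∈ Finset.range L, a r i = ∑ p ∈ T, a p.1 p.2 := by rw [hT, Finset.sum_product]
  have h2 : ∑ r : Fin d → Fin L, ∑ i ∈ Finset.range L, a r i ^ 2 = ∑ p ∈ T, a p.1 p.2 ^ 2 := by rw [hT, Finset.sum_product]
  have hcs : (∑ p ∈ T, a p.1 p.2) ^ 2 ≤ T.card * ∑ p ∈ T, a p.1 p.2 ^ 2 := sq_sum_le_card_mul_sum_sq
  rw [h1, h2]
  calc (((L : ℝ) ^ (d + 1))⁻¹ * ∑ p ∈ T, a p.1 p.2) ^ 2 = (((L : ℝ) ^ (d + 1))⁻¹) ^ 2 * (∑ p ∈ T, a p.1 p.2) ^ 2 := by ring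
    _ ≤ (((L : ℝ) ^ (d + 1))⁻¹) ^ 2 * (T.card * ∑ p ∈ T, a p.1 p.2 ^ 2) := mul_le_mul_of_nonneg_left hcs (by positivity)
    _ = ((L : ℝ) ^ (d + 1))⁻¹ * ∑ p ∈ T, a p.1 p.2 ^ 2 := by rw [hcard]; field_simp

/-- the norm of the sweep weight read as a complex scalar: `‖(L^{d+1})⁻¹‖ = L^{−(d+1)}`. [folklore] [cite: Balaban1985Averaging, (125) p.36] -/
theorem norm_sweep_weight : ‖((L : ℂ) ^ (d + 1))⁻¹‖ = ((L : ℝ) ^ (d + 1))⁻¹ := by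
  rw [norm_inv, norm_pow, Complex.norm_natCast]

variable [Fact (0 < c₀)] [Fact (0 < c₁)]

include hL in
/-- **THE `L²` TRANSFER ALONG THE SWEEPS**: if a finite family `G_j` of coarse bond functions is controlled pointwise by the sweep means of the squares
of a fine bond function `f` — `Σ_j ‖G_j(c)‖² ≤ K·L^{−(d+1)}Σ_{sweep(c)}‖f‖²` — then on the chain's weighted carriers (fine weight `c₀`, coarse weight `c₁`)
`Σ_j ‖G_j‖² ≤ K·(c₁∕(c₀L^d))·‖f‖²`; volume-free. [folklore] [cite: Balaban1985BackgroundPropagators, (3.11) p.392, (3.15)–(3.16) p.393; Balaban1985Averaging, (125) p.36] -/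
theorem sum_norm_sq_le_of_sweep_bound {J : Type*} (s : Finset J) (f : BondL2K ℂ d (fineP L m) c₀ W) (G : J → BondL2K ℂ d m c₁ W)
    {K : ℝ} (hK : 0 ≤ K)
    (h : ∀ c : Bond d m, ∑ j ∈ s, ‖WL2.equiv ℂ _ W (G j) c‖ ^ 2 ≤ K * (((L : ℝ) ^ (d + 1))⁻¹ * ∑ r : Fin d → Fin L, ∑ i ∈ Finset.range L,
      ‖WL2.equiv ℂ _ W f (perSite (fineP L m) (cornerSite L c.1 + boxVec L r + (i : ℤ) • e c.2), c.2)‖ ^ 2)) :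
    ∑ j ∈ s, ‖G j‖ ^ 2 ≤ K * (c₁ / (c₀ * (L : ℝ) ^ d)) * ‖f‖ ^ 2 := by
  haveI : NeZero L := ⟨by omega⟩
  have hc₀ : 0 < c₀ := Fact.out
  have hc₁ : 0 < c₁ := Fact.out
  have hLd : (0 : ℝ) < (L : ℝ) ^ d := by positivity
  have hn : ‖f‖ ^ 2 = ∑ b, c₀ * ‖WL2.equiv ℂ (fun _ : Bond d (fineP L m) => c₀) W f b‖ ^ 2 :=
    WL2.norm_sq (𝕜 := ℂ) (w := fun _ : Bond d (fineP L m) => c₀) (V := W) f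
  have hG : ∀ j, ‖G j‖ ^ 2 = ∑ c, c₁ * ‖WL2.equiv ℂ (fun _ : Bond d m => c₁) W (G j) c‖ ^ 2 := fun j =>
    WL2.norm_sq (𝕜 := ℂ) (w := fun _ : Bond d m => c₁) (V := W) (G j)
  have hsw := sum_sweep_mean_le L m hL (fun b => ‖WL2.equiv ℂ (fun _ : Bond d (fineP L m) => c₀) W f b‖ ^ 2) fun _ => sq_nonneg _
  calc ∑ j ∈ s, ‖G j‖ ^ 2 = ∑ j ∈ s, ∑ c, c₁ * ‖WL2.equiv ℂ (fun _ : Bond d m => c₁) W (G j) c‖ ^ 2 := Finset.sum_congr rfl fun j _ => hG j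
    _ = c₁ * ∑ c, ∑ j ∈ s, ‖WL2.equiv ℂ (fun _ : Bond d m => c₁) W (G j) c‖ ^ 2 := by
        rw [Finset.sum_comm, Finset.mul_sum]
        exact Finset.sum_congr rfl fun c _ => by rw [Finset.mul_sum]
    _ ≤ c₁ * ∑ c : Bond d m, K * (((L : ℝ) ^ (d + 1))⁻¹ * ∑ r : Fin d → Fin L, ∑ i ∈ Finset.range L,
          ‖WL2.equiv ℂ _ W f (perSite (fineP L m) (cornerSite L c.1 + boxVec L r + (i : ℤ) • e c.2), c.2)‖ ^ 2) :=
        mul_le_mul_of_nonneg_left (Finset.sum_le_sum fun c _ => h c) hc₁.le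
    _ ≤ c₁ * (K * (((L : ℝ) ^ d)⁻¹ * ∑ b, ‖WL2.equiv ℂ (fun _ : Bond d (fineP L m) => c₀) W f b‖ ^ 2)) := by
        rw [← Finset.mul_sum]
        exact mul_le_mul_of_nonneg_left (mul_le_mul_of_nonneg_left hsw hK) hc₁.le
    _ = K * (c₁ / (c₀ * (L : ℝ) ^ d)) * ‖f‖ ^ 2 := by
        rw [hn, ← Finset.mul_sum]
        field_simp

include hL in
/-- The one-function case of `sum_norm_sq_le_of_sweep_bound`: `‖G(c)‖² ≤ K·L^{−(d+1)}Σ_{sweep(c)}‖f‖²` for every `c` gives `‖G‖² ≤ K·(c₁∕(c₀L^d))·‖f‖²`.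
[folklore] [cite: Balaban1985BackgroundPropagators, (3.11) p.392, (3.15)–(3.16) p.393] -/
theorem norm_sq_le_of_sweep_bound (f : BondL2K ℂ d (fineP L m) c₀ W) (G : BondL2K ℂ d m c₁ W) {K : ℝ} (hK : 0 ≤ K)
    (h : ∀ c : Bond d m, ‖WL2.equiv ℂ _ W G c‖ ^ 2 ≤ K * (((L : ℝ) ^ (d + 1))⁻¹ * ∑ r : Fin d → Fin L, ∑ i ∈ Finset.range L,
      ‖WL2.equiv ℂ _ W f (perSite (fineP L m) (cornerSite L c.1 + boxVec L r + (i : ℤ) • e c.2), c.2)‖ ^ 2)) :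
    ‖G‖ ^ 2 ≤ K * (c₁ / (c₀ * (L : ℝ) ^ d)) * ‖f‖ ^ 2 := by
  have h1 := sum_norm_sq_le_of_sweep_bound L m hL (Finset.univ : Finset Unit) f (fun _ => G) hK (fun c => by simpa using h c)
  simpa using h1

include hL in
/-- Square roots: `‖G‖² ≤ K²·(c₁∕(c₀L^d))·‖f‖²`, `0 ≤ K` ⟹ `‖G‖ ≤ K·√(c₁∕(c₀L^d))·‖f‖`. [folklore] [cite: Balaban1985BackgroundPropagators, (3.11) p.392] -/
theorem norm_le_of_sweep_bound (f : BondL2K ℂ d (fineP L m) c₀ W) (G : BondL2K ℂ d m c₁ W) {K : ℝ} (hK : 0 ≤ K)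
    (h : ∀ c : Bond d m, ‖WL2.equiv ℂ _ W G c‖ ^ 2 ≤ K ^ 2 * (((L : ℝ) ^ (d + 1))⁻¹ * ∑ r : Fin d → Fin L, ∑ i ∈ Finset.range L,
      ‖WL2.equiv ℂ _ W f (perSite (fineP L m) (cornerSite L c.1 + boxVec L r + (i : ℤ) • e c.2), c.2)‖ ^ 2)) :
    ‖G‖ ≤ K * Real.sqrt (c₁ / (c₀ * (L : ℝ) ^ d)) * ‖f‖ := by
  have hc₀ : 0 < c₀ := Fact.out
  have hc₁ : 0 < c₁ := Fact.out
  have hr : 0 ≤ c₁ / (c₀ * (L : ℝ) ^ d) := by positivity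
  have h1 := norm_sq_le_of_sweep_bound L m hL f G (sq_nonneg K) h
  have h2 : ‖G‖ ^ 2 ≤ (K * Real.sqrt (c₁ / (c₀ * (L : ℝ) ^ d)) * ‖f‖) ^ 2 := by
    rw [mul_pow, mul_pow, Real.sq_sqrt hr]; exact h1
  exact (pow_le_pow_iff_left₀ (norm_nonneg _) (by positivity) two_ne_zero).1 h2

end Sweep

/-! ## §2 The flat one-step vector averaging `Q(1)` on the carriers IS the sweep mean (the fibre readings cancel); the letter `t₃` -/

section FlatMean

variable {𝔸 : Type*} [NormedRing 𝔸] [NormOneClass 𝔸] [NormedAlgebra ℂ 𝔸] [CompleteSpace 𝔸]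
  {α' : ℝ} (hα1' : α' ≤ 1 / 64)
  (hU1' : ∀ (x : B7Prop1Explicit.Site d) (κ : Fin d), perCfg (fineP L m) (fun _ : Bond d (fineP L m) => (1 : 𝔸ˣ)) x κ ∈ U1 𝔸)
  (hreg' : ∀ (y : TSite d m) (κ : Fin d) (r : Fin d → Fin L),
    ‖((Wcx L (perCfg (fineP L m) (fun _ : Bond d (fineP L m) => (1 : 𝔸ˣ))) (cornerSite L y) κ (boxVec L r) : 𝔸ˣ) : 𝔸) - 1‖ ≤ α')
  {W : Type*} [NormedAddCommGroup W] [InnerProductSpace ℂ W] (φ : W ≃ₗ[ℂ] 𝔸) {c₀ c₁ : ℝ}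

/-- **`Q(1)` ON THE CARRIERS IS THE SWEEP MEAN** — the fibre readings `φ`, `φ⁻¹` CANCEL at the flat background:
`(Q(1)f)(y, κ) = L^{−(d+1)}·Σ_{r∈[0,L)^d} Σ_{i<L} f((L·y + r + ie_κ) mod L·m, κ)`. [cite: Balaban1985Averaging, (125) p.36; Balaban1985BackgroundPropagators, (3.15) p.393] -/
theorem QtorusW_one_apply_eq_sum (f : BondL2K ℂ d (fineP L m) c₀ W) (c : Bond d m) :
    WL2.equiv ℂ _ W (QtorusW L m hL φ (fun _ => 1) hα1' hU1' hreg' (c₁ := c₁) f) c =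
      ((L : ℂ) ^ (d + 1))⁻¹ • ∑ r : Fin d → Fin L, ∑ i ∈ Finset.range L,
        WL2.equiv ℂ _ W f (perSite (fineP L m) (cornerSite L c.1 + boxVec L r + (i : ℤ) • e c.2), c.2) := by
  rw [QtorusW_apply, QtorusLin_one_apply L m hL hα1' hU1' hreg', LinearMapClass.map_smul_of_tower φ.symm]
  simp only [map_sum, LinearEquiv.symm_apply_apply]
  have hsm := Complex.coe_smul (((L : ℝ) ^ (d + 1))⁻¹) (∑ r : Fin d → Fin L, ∑ i ∈ Finset.range L,
    WL2.equiv ℂ _ W f (perSite (fineP L m) (cornerSite L c.1 + boxVec L r + (i : ℤ) • e c.2), c.2))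
  push_cast at hsm
  exact hsm.symm

/-- **POINTWISE SIZE OF `Q(1)` ITSELF** (the `t₃` integrand, fibre-free): `‖(Q(1)f)(c)‖² ≤ L^{−(d+1)}Σ_{sweep(c)}‖f‖²`.
[cite: Balaban1985Averaging, (125) p.36; Balaban1985BackgroundPropagators, (3.15) p.393] -/
theorem norm_sq_QtorusW_one_apply_le (f : BondL2K ℂ d (fineP L m) c₀ W) (c : Bond d m) :
    ‖WL2.equiv ℂ _ W (QtorusW L m hL φ (fun _ => 1) hα1' hU1' hreg' (c₁ := c₁) f) c‖ ^ 2 ≤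
      ((L : ℝ) ^ (d + 1))⁻¹ * ∑ r : Fin d → Fin L, ∑ i ∈ Finset.range L,
        ‖WL2.equiv ℂ _ W f (perSite (fineP L m) (cornerSite L c.1 + boxVec L r + (i : ℤ) • e c.2), c.2)‖ ^ 2 := by
  have h1 : ‖WL2.equiv ℂ _ W (QtorusW L m hL φ (fun _ => 1) hα1' hU1' hreg' (c₁ := c₁) f) c‖ ≤
      ((L : ℝ) ^ (d + 1))⁻¹ * ∑ r : Fin d → Fin L, ∑ i ∈ Finset.range L,
        ‖WL2.equiv ℂ _ W f (perSite (fineP L m) (cornerSite L c.1 + boxVec L r + (i : ℤ) • e c.2), c.2)‖ := by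
    rw [QtorusW_one_apply_eq_sum L m hL hα1' hU1' hreg', norm_smul, norm_sweep_weight]
    exact mul_le_mul_of_nonneg_left ((norm_sum_le _ _).trans (Finset.sum_le_sum fun r _ => norm_sum_le _ _)) (by positivity)
  exact (pow_le_pow_left₀ (norm_nonneg _) h1 2).trans (sq_sweep_mean_le L hL _)


variable [Fact (0 < c₀)] [Fact (0 < c₁)]


/-- **`‖Q(1)f‖² ≤ (c₁∕(c₀L^d))·‖f‖²`** on the weighted `L²` carriers of `W`-valued 1-forms (fine weight `c₀`, coarse weight `c₁`) — the fibre readings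
`φ`, `φ⁻¹` cancel at the flat background, so NO `M_φM_φ′` (cf. `B9Eq315QFlatNorm.norm_QtorusW_one_le`); `= ‖f‖²` at the one-level weights `c₁ = c₀L^d`;
volume-free. [cite: Balaban1985BackgroundPropagators, (3.15)–(3.16) p.393, (3.11) p.392; Balaban1985Averaging, (125) p.36] -/
theorem norm_sq_QtorusW_one_le (f : BondL2K ℂ d (fineP L m) c₀ W) :
    ‖QtorusW L m hL φ (fun _ => 1) hα1' hU1' hreg' (c₁ := c₁) f‖ ^ 2 ≤ (c₁ / (c₀ * (L : ℝ) ^ d)) * ‖f‖ ^ 2 := by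
  have h := norm_sq_le_of_sweep_bound L m hL f (QtorusW L m hL φ (fun _ => 1) hα1' hU1' hreg' (c₁ := c₁) f) zero_le_one
    (fun c => by simpa using norm_sq_QtorusW_one_apply_le L m hL hα1' hU1' hreg' φ (c₁ := c₁) f c)
  simpa using h

/-- **THE LETTER `t₃`**: `‖Q(1)f‖ ≤ √(c₁∕(c₀L^d))·‖f‖` — fibre-free, volume-free. [cite: Balaban1985BackgroundPropagators, (3.15)–(3.16) p.393; Balaban1985Averaging, (125) p.36] -/
theorem norm_QtorusW_one_le (f : BondL2K ℂ d (fineP L m) c₀ W) :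
    ‖QtorusW L m hL φ (fun _ => 1) hα1' hU1' hreg' (c₁ := c₁) f‖ ≤ Real.sqrt (c₁ / (c₀ * (L : ℝ) ^ d)) * ‖f‖ := by
  have h := norm_le_of_sweep_bound L m hL f (QtorusW L m hL φ (fun _ => 1) hα1' hU1' hreg' (c₁ := c₁) f) zero_le_one
    (fun c => by simpa using norm_sq_QtorusW_one_apply_le L m hL hα1' hU1' hreg' φ (c₁ := c₁) f c)
  simpa using h

end FlatMean

end Literature.MathematicalPhysics.QuantumFieldTheory.Balaban1983to89.B9Eq315QFlatSweep

end
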